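import Summits.BirchSwinnertonDyer.BirchSwinnertonDyer.Theses.KatoDescentTamePotSupersingular
import Summits.BirchSwinnertonDyer.Rank1Residual.O6.KatoHullRankOneDescent
import Summits.BirchSwinnertonDyer.Rank1Residual.O6.PotGoodOfHullKMC
import HarnessLib

/-!
# Route `KatoDescentTamePotSupersingular` (rung K8-t′, cell `bsd-potss`): the declared residual
# `TameRankOne` (item stmt-BirchSwinnertonDyer-19984) FROM KMC_p ∧ PR^× IN HULL CURRENCY — at ANY member,
# rational `p`-torsion allowed; no torsion-free member, no Mazur–Kenku walk (a `--supports … --as helper` file)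

The sibling helper `KatoDescentTamePotSupersingularTameRankOneOfKMC.lean` (seat kmc part 10/14, p417959)
ran the rank-one descent at the `p`-TORSION-FREE member (readings `TorsionFree.*`, named fact
`mazurKenku_exists_cyclic_isogeny`), because Burns–Kurihara–Sano's rank-one count carries the standing
hypothesis "`H¹(ℤ_S,T)` is `ℤ_p`-free" (= `E(ℚ)[p] = 0`). Part 15 of the descent files
(`O6/KatoHullRankOneExactCount.lean`, `O6/KatoHullRankOneDescent.lean`, `O6/PotGoodRankOneOfHullKMC.lean`)
removes it: the exact rank-one count at an arbitrary member, `v_p ℒ = m + ord_p #Ш + v_p Tam − 2t`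
(Reading M3♯-r1), gives `KMC ∧ PR^× ⟹ BSD_p` at every hull-realised member; the glue then needs only
Reading M1♯ (`KatoHull.Realizable`), Reading M3♯-r1, `KatoHull.ReadsKMC`, Cassels / GZK / modularity, and
KMC_p ∧ PR^× at the additive potentially good rank-one curves. This file restates it with the ROUTE DECL
as its type. CONDITIONAL (audit `proof.conditional`); the item is NOT closed. Seat `bsd-potss-kmc` gen. 8.

References: [Kato2004Asterisque] Conj. 12.10 (p. 224), §14.14 (p. 243); [BurnsKuriharaSano2019] Conj.
1.5 (p. 5), Hyp. 2.2 (p. 9), Thm. 7.3 / 7.6 (p. 29); [Cassels1965ArithmeticVIII]; [Miller2011LMS] Def. 1.1.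
-/

set_option autoImplicit false
-- sibling precedent (`KatoDescentTamePotSupersingularAssembly.lean`): the directory name repeats the summit name
set_option linter.dupNamespace false

noncomputable section

open scoped Classical

namespace Summit.BirchSwinnertonDyer.BirchSwinnertonDyer.Theorems

open WeierstrassCurve Literature.NumberTheory.EllipticCurves
  Literature.NumberTheory.EllipticCurves.Rank1Residual
  Literature.NumberTheory.EllipticCurves.Rank1Residual.Typed
  Summit.BirchSwinnertonDyer.Rank1Residual.Additive
  Summit.BirchSwinnertonDyer.Rank1Residual
  Summit.BirchSwinnertonDyer.BirchSwinnertonDyer.Theses.KatoDescentTamePotSupersingular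

variable {IsHullOf : ∀ (W : WeierstrassCurve ℚ) [W.IsElliptic] [W.IsGloballyMinimal] (p : ℕ)
  [Fact p.Prime], KatoHullDescentDatum p → Prop}
variable {PRRatio : ∀ (W : WeierstrassCurve ℚ) [W.IsElliptic] [W.IsGloballyMinimal] (p : ℕ)
  [Fact p.Prime], ℚ_[p] → Prop}
variable {KMC : ∀ (W : WeierstrassCurve ℚ) [W.IsElliptic] [W.IsGloballyMinimal] (p : ℕ), Prop}

/-- **Rank-one DescentGlue for the K8-t′ residual `TameRankOne`, hull currency**: KMC_p ∧ PR^× at every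
additive potentially good analytic-rank-one curve (hypothesis `hKP`), over Readings M1♯ / M3♯-r1, the
interface lemma `ReadsKMC`, and Cassels / GZK / modularity ⟹ `TameRankOne` (type = the route decl
verbatim), from `KatoHull.rankOne_bsdp_of_kmc_of_perrinRiou` at the realised member + Cassels. ANY rational `p`-torsion at the realised member;
no Mazur–Kenku. Conditional over displayed hypotheses; nothing about Kato's objects or Perrin-Riou's
conjecture is asserted; the item is not closed.
[cite: Kato2004Asterisque, Conj. 12.10 (p. 224), §14.14 (p. 243)] [cite: BurnsKuriharaSano2019, Conj. 1.5 (p. 5), Thm. 7.3 and Thm. 7.6 (p. 29)]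
[cite: Cassels1965ArithmeticVIII] -/
theorem tameRankOne_of_hullKMC_of_perrinRiou (hRz : KatoHull.Realizable IsHullOf)
    (hC : KatoHull.RankOneExactCountReading IsHullOf PRRatio) (hK : KatoHull.ReadsKMC IsHullOf KMC)
    (hCassels : bsdRHS_eq_of_isIsogenous) (hGZK : rank_eq_analyticRank_of_analyticRank_le_one)
    (hmod : hasEntireLFunction_rat)
    (hKP : ∀ (W : WeierstrassCurve ℚ) [W.IsElliptic] [W.IsGloballyMinimal] (p : ℕ) [Fact p.Prime],
      W.analyticRank = 1 → p ≠ 2 → Addv W p → 0 ≤ padicValRat p W.j →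
        KMC W p ∧ PerrinRiouUpToUnitAt PRRatio W p) :
    Summit.BirchSwinnertonDyer.BirchSwinnertonDyer.Theses.KatoDescentTamePotSupersingular.TameRankOne := by
  intro W _ _ p _ hr hp hadd hT
  have hO5 : ClassO5 W p := ⟨hp, hadd, Or.inr hT⟩
  have hj : 0 ≤ padicValRat p W.j := hO5.padicValRat_j_nonneg
  haveI : Finite W.sha := (hGZK W (by rw [hr])).2
  refine missingPPartAt_of_bsdp W p ?_
  -- a hull datum at some member `W'` of the class (Reading M1♯), the hypotheses transported to it
  obtain ⟨W', hE', hM', hiso, D, hDof⟩ := hRz W p hp hadd hj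
  obtain ⟨hadd', hj'⟩ := Addv.of_isIsogenous_of_padicValRat_j_nonneg (p := p) hadd hj hiso
  have hr' : W'.analyticRank = 1 := by rw [← analyticRank_eq_of_isIsogenous' hiso, hr]
  obtain ⟨hkmc', hPR'⟩ := hKP W' p hr' hp hadd' hj'
  -- KMC ∧ PR^× ⟹ BSD_p at the realised member (any torsion), then Cassels back to `W`
  have hbsd' : BSDp W' p :=
    KatoHull.rankOne_bsdp_of_kmc_of_perrinRiou hC hK hGZK hmod hp hadd' hj' hr' hDof hkmc' hPR'
  exact N10.bsdp_of_isIsogenous_of_bsdp p hCassels hGZK hmod hiso (by rw [hr]) hbsd'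

end Summit.BirchSwinnertonDyer.BirchSwinnertonDyer.Theorems

end
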